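import Summits.BirchSwinnertonDyer.BirchSwinnertonDyer.Theses.CountingDoorF2AtThree
import Summits.BirchSwinnertonDyer.BirchSwinnertonDyer.Theorems.CountingDoorF2AtThreeRootNumberClosedForm
import Summits.BirchSwinnertonDyer.BirchSwinnertonDyer.Theorems.CountingDoorF2AtThreeSemistableRootNumberSquarefree
import Summits.BirchSwinnertonDyer.BirchSwinnertonDyer.Theorems.CountingDoorF2AtThreeRefinedDoorFamily
import Literature.NumberTheory.EllipticCurves.BhargavaHo2022.LargeFamilyCount
import HarnessLib

/-!
# BirchSwinnertonDyer / CountingDoorF2AtThree — crux I2 `RootNumberPlusLowerDensityLargeF2`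
# (stmt-BirchSwinnertonDyer-19441) IS a `2/3`-bias statement for the root number, BY NAME; and its
# door-family instance reads an EXPLICIT Liouville–Jacobi sign (lane «closed-form local root numbers»)

Route `route-BirchSwinnertonDyer-CountingDoorF2AtThree` (cell bsd-rank2, WIDTH-LEVER lane B
`bsd-rank2-rootno-p2`). BY-NAME statements about the route decl `RootNumberPlusLowerDensityLargeF2`:

* `averageOnLE_neg_rootNumber_of_densityOnGE` / (tree) `densityOnGE_rootNumber_of_averageOnLE` — on a
  congruence subfamily, «root number `+1` with lower density `≥ ρ`» and «`limsup` of the average of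
  `−w` is `≤ 1 − 2ρ`» are the same statement (`#{w = +1} = ∑ (1 + w)/2`);
* `rootNumberPlusLowerDensityLargeF2_iff_bias` — **I2 ⟺ on every large `Φ` with nonempty local
  conditions the height balls are eventually nonempty and the average of `−w(E_a)` has `limsup < 2/3`**
  (a BIAS bound, not equidistribution: `θ < 2/3 ⟺ ρ = (1 − θ)/2 > 1/6`); with Bhargava–Ho Thm. 9.1
  (`thm9_1_F2`, by name) the nonemptiness clause is automatic
  (`eventually_card_below_pos_of_isLarge`, `rootNumberPlusLowerDensityLargeF2_of_bias`);
* `exists_doorFamily_rootNumberPlus_of_liouvilleJacobi_bias` — THE DOOR-FAMILY INSTANCE: on the cell's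
  refined door family `Φ***` (eng-2 `exists_refinedDoorFamily`: large, nonempty residues, the door
  conditions, and SQUAREFREE `Δ(a)` for every member) the root number of EVERY member is the explicit
  sign `−σ(a)`, `σ(a) = ∏_{p ∣ Δ(a)} s_p(a)` (`s₂ = −1` iff `2 ∣ a₁a₃`, `s_p = −J(−c₄(a)c₆(a) | p)`), modulo
  the Modularity Theorem; hence `Φ***.AverageOnLE σ θ` with `θ < 2/3` gives I2's conclusion
  `∃ ρ > 1/6, Φ***.DensityOnGE (w = +1) ρ` on the very family the route's closing chain
  (`leaf_of_cruxes_without_largeFamilyInputs`) applies I2 to — with NO Selmer group, NO `L`-function and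
  NO root number left in the hypothesis.

* `exists_doorFamily_liouvilleJacobi_bias_of_rootNumberPlusLowerDensityLargeF2` — THE TYPED OBSTRUCTION
  (converse direction): I2 ⇒ on `Φ***` the explicit sign `σ` has `limsup` average `< 2/3` — any proof of
  I2 proves a `2/3`-bias weak-Chowla statement for `(Δ_{F₂}, J)` on a congruence-sieve family.

* §5 `liouvilleJacobiBias_of_rootNumberPlusLowerDensityLargeF2` (I2 ⇒ I2sf: the bias bound on EVERY
  large squarefree-member family) and `pAdicBSDRankTwoPositiveProportion_of_selmerAverage_of_liouvilleJacobiBias`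
  (PublishedInputsAtThree → I1 → Modularity → I2sf → leaf): I2sf is a strictly weaker re-typing of I2 that
  still closes the leaf; `pAdicBSDRankTwoPositiveProportion_of_cappedAverage_of_liouvilleJacobiBias` — the
  trade-off: with a capped Selmer average `A` the bias bound is needed only with `27θ + A < 54`.

HONEST STATUS: the bias bound (weak Chowla (wC) for `λ(Δ_{F₂})·J` on congruence boxes, ideation census
561570aeecec) is OPEN; I2 is not proved here. This file only makes «what exactly must be bounded, and by
how much» a kernel-checked statement. PARTITION: none — r_an ≥ 2, summit axis S0; TWIN (D-0056): n/a.
B1 honesty: bookkeeping; nothing reads r_an; no S0 motion.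

References: M. Bhargava, W. Ho, arXiv:2207.03309 Thm. 9.1 [BhargavaHo2022]; H. A. Helfgott,
arXiv:math/0408141 §1 [Helfgott2004RootNumber]; D. Rohrlich, *Compositio Math.* 87 (1993) Prop. 2
[Rohrlich1993Compositio].
-/

set_option linter.dupNamespace false
set_option autoImplicit false

noncomputable section

open scoped Classical NumberTheorySymbols

open Filter Topology Finset WeierstrassCurve
  Literature.NumberTheory.EllipticCurves.BhargavaHo2022
  Summit.BirchSwinnertonDyer.BirchSwinnertonDyer.Theses.CountingDoorF2AtThree
  Summit.BirchSwinnertonDyer.BirchSwinnertonDyer.Theorems.SemistableRootNumber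
  Summit.BirchSwinnertonDyer.BirchSwinnertonDyer.Theorems.F2RootNumber

namespace Summit.BirchSwinnertonDyer.BirchSwinnertonDyer.Theorems.F2RootNumber

/-! ### §1 Lower density of `w = +1` versus the average of `−w` -/

/-- **Converse bookkeeping**: if root number `+1` has lower density `≥ ρ` on `Φ` and the height balls
are eventually nonempty, then the average of `−w(E_a)` over `Φ(<X)` has `limsup ≤ 1 − 2ρ`
(`∑ (−w) = #Φ(<X) − 2·#{w = +1}`). [folklore] -/
theorem averageOnLE_neg_rootNumber_of_densityOnGE (Φ : CongruenceFamily₂) {ρ : ℝ}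
    (hne : ∀ᶠ X : ℕ in atTop, 0 < (Φ.below X).card)
    (hρ : Φ.DensityOnGE (fun a ↦ a.curve.rootNumber = 1) ρ) :
    Φ.AverageOnLE (fun a ↦ -(a.curve.rootNumber : ℝ)) (1 - 2 * ρ) := by
  intro ε hε
  filter_upwards [hne, hρ (ε / 2) (half_pos hε)] with X hX hD
  have hc : (0 : ℝ) < (Φ.below X).card := by exact_mod_cast hX
  unfold CongruenceFamily₂.proportionOn CongruenceFamily₂.averageOn at *
  rw [le_div_iff₀ hc] at hD
  rw [div_le_iff₀ hc]
  have hpt : ∀ a ∈ Φ.below X, -(a.curve.rootNumber : ℝ) =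
      1 - 2 * (if a.curve.rootNumber = 1 then (1 : ℝ) else 0) := by
    intro a _
    rcases a.curve.rootNumber_eq_one_or with h | h
    · rw [if_pos h, h]; norm_num
    · rw [if_neg (by rw [h]; norm_num), h]; norm_num
  have hS : ∑ a ∈ Φ.below X, -(a.curve.rootNumber : ℝ) =
      (Φ.below X).card - 2 * ∑ a ∈ Φ.below X, (if a.curve.rootNumber = 1 then (1 : ℝ) else 0) := by
    rw [Finset.sum_congr rfl hpt, Finset.sum_sub_distrib, Finset.sum_const, nsmul_eq_mul, mul_one,
      Finset.mul_sum]
  have hD' : (ρ - ε / 2) * ((Φ.below X).card : ℝ) ≤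
      ∑ a ∈ Φ.below X, (if a.curve.rootNumber = 1 then (1 : ℝ) else 0) := by
    refine hD.trans (le_of_eq (Finset.sum_congr rfl fun a _ ↦ ?_))
    beta_reduce
    split_ifs <;> rfl
  show ∑ a ∈ Φ.below X, -(a.curve.rootNumber : ℝ) ≤ (1 - 2 * ρ + ε) * (Φ.below X).card
  rw [hS]
  nlinarith [hD', hc, hε]

/-! ### §2 I2 is a `2/3`-bias statement (by name) -/

/-- **Crux I2 ⟺ a `2/3`-bias bound for the root number on every large family.**
`RootNumberPlusLowerDensityLargeF2` holds iff for every large `Φ ⊆ F₂` with a nonempty local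
condition at every prime, the height balls `Φ(<X)` are eventually nonempty and the average of
`−w(E_a)` over `Φ(<X)` is eventually `≤ θ + ε` (all `ε > 0`) for some `θ < 2/3`.
(`ρ > 1/6 ⟺ θ = 1 − 2ρ < 2/3`; equidistribution would be `θ = 0`.)
[cite: Helfgott2004RootNumber, §1] [cite: BhargavaHo2022, §1] -/
theorem rootNumberPlusLowerDensityLargeF2_iff_bias :
    RootNumberPlusLowerDensityLargeF2 ↔
      ∀ Φ : CongruenceFamily₂, Φ.IsLarge → (∀ p : ℕ, p.Prime → (Φ.residues p).Nonempty) →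
        (∀ᶠ X : ℕ in atTop, 0 < (Φ.below X).card) ∧
          ∃ θ : ℝ, θ < 2 / 3 ∧ Φ.AverageOnLE (fun a ↦ -(a.curve.rootNumber : ℝ)) θ := by
  constructor
  · intro h Φ hL hne
    obtain ⟨ρ, hρ, hD⟩ := h Φ hL hne
    have hpos := eventually_card_below_pos_of_densityOnGE Φ hD (by linarith)
    exact ⟨hpos, 1 - 2 * ρ, by linarith, averageOnLE_neg_rootNumber_of_densityOnGE Φ hpos hD⟩
  · intro h Φ hL hne
    obtain ⟨hpos, θ, hθ, hA⟩ := h Φ hL hne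
    exact ⟨(1 - θ) / 2, by linarith, densityOnGE_rootNumber_of_averageOnLE Φ hpos hA⟩

/-- The parameters `(0, 1, −1, 0)` (the curve `y² = x³ − x`, `Δ = 64`) are a member of `F₂` of height
`1`, so the height balls of the whole family are nonempty from `X = 2` on. [cite: BhargavaHo2022, §1] -/
theorem card_all_below_pos {X : ℕ} (hX : 2 ≤ X) : 0 < (CongruenceFamily₂.all.below X).card := by
  refine Finset.card_pos.mpr ⟨⟨0, 1, -1, 0⟩, (CongruenceFamily₂.all.mem_below_iff _ _).mpr
    ⟨(CongruenceFamily₂.mem_all_iff _).mpr ?_, ?_⟩⟩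
  · show (⟨0, 1, -1, 0⟩ : Params).curveInt.Δ ≠ 0
    rw [curveInt_Δ]; norm_num
  · show (⟨0, 1, -1, 0⟩ : Params).height < X
    simp only [Params.height]
    norm_num
    omega

/-- **A large family with nonempty local conditions has eventually nonempty height balls**, modulo
Bhargava–Ho Thm. 9.1 (`thm9_1_F2`: positive lower relative density in `F₂`).
[cite: BhargavaHo2022, Thm. 9.1 (§9.1, p. 31)] -/
theorem eventually_card_below_pos_of_isLarge (h9 : thm9_1_F2) (Φ : CongruenceFamily₂) (hL : Φ.IsLarge)
    (hne : ∀ p : ℕ, p.Prime → (Φ.residues p).Nonempty) :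
    ∀ᶠ X : ℕ in atTop, 0 < (Φ.below X).card := by
  obtain ⟨δ, hδ, hev⟩ := thm9_1_F2.relative h9 Φ hL hne
  filter_upwards [hev, eventually_ge_atTop 2] with X hX h2
  have hall : (0 : ℝ) < (CongruenceFamily₂.all.below X).card := by exact_mod_cast card_all_below_pos h2
  have : (0 : ℝ) < (Φ.below X).card := lt_of_lt_of_le (mul_pos hδ hall) hX
  exact_mod_cast this

/-- **I2 from a `2/3`-bias bound on every large family** (modulo Bhargava–Ho Thm. 9.1 for the
nonemptiness of the height balls): if for every large `Φ` with nonempty local conditions some `θ < 2/3`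
bounds the `limsup` of the average of `−w(E_a)`, then `RootNumberPlusLowerDensityLargeF2`.
[cite: BhargavaHo2022, Thm. 9.1] [cite: Helfgott2004RootNumber, §1] -/
theorem rootNumberPlusLowerDensityLargeF2_of_bias (h9 : thm9_1_F2)
    (hbias : ∀ Φ : CongruenceFamily₂, Φ.IsLarge → (∀ p : ℕ, p.Prime → (Φ.residues p).Nonempty) →
      ∃ θ : ℝ, θ < 2 / 3 ∧ Φ.AverageOnLE (fun a ↦ -(a.curve.rootNumber : ℝ)) θ) :
    RootNumberPlusLowerDensityLargeF2 :=
  rootNumberPlusLowerDensityLargeF2_iff_bias.mpr fun Φ hL hne ↦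
    ⟨eventually_card_below_pos_of_isLarge h9 Φ hL hne, hbias Φ hL hne⟩

/-! ### §3 The door-family instance: the hypothesis is an explicit Liouville–Jacobi average -/

/-- `∀ ℓ prime, ℓ² ∤ n` means `n` is squarefree (for `n = 0` both sides fail). [folklore] -/
theorem squarefree_of_forall_not_sq_dvd {n : ℤ}
    (h : ∀ ℓ : ℕ, ℓ.Prime → ¬ ((ℓ : ℤ) ^ 2 ∣ n)) : Squarefree n := by
  rw [← Int.squarefree_natAbs, Nat.squarefree_iff_prime_squarefree]
  intro p hp hdvd
  refine h p hp ?_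
  have hz : ((p * p : ℕ) : ℤ) ∣ n := Int.natCast_dvd.mpr hdvd
  rw [Nat.cast_mul, ← sq] at hz
  exact hz

/-- **The door-family instance of the typed door.** There is a large congruence subfamily `Φ` of `F₂` with
a nonempty local condition at every prime — the cell's refined door family `Φ***` of
`exists_refinedDoorFamily`, containing `a* = (−524, 450, −374, 3825)` and carrying the door conditions
(ρ̄₃ irreducible; ordinary at `3` with a Skinner–Urban auxiliary prime on every globally minimal model;
squarefree `Δ(a)`; trivial torsion and rank `≥ 2`) for EVERY member — on which, modulo the Modularity
Theorem, (i) every member's root number is the explicit sign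
`w(E_a) = −∏_{p ∣ Δ(a)} s_p(a)` (`s₂ = −1` iff `2 ∣ a₁a₃`, `s_p = −J(−c₄(a)c₆(a) | p)`), and (ii) for every
`θ < 2/3`, `Φ.AverageOnLE σ θ` for `σ(a) = ∏_{p ∣ Δ(a)} s_p(a)` implies I2's conclusion on `Φ`:
`∃ ρ > 1/6, Φ.DensityOnGE (w = +1) ρ`. [cite: Helfgott2004RootNumber, §1]
[cite: Rohrlich1993Compositio, Prop. 2] [cite: BhargavaHo2022, §1] -/
theorem exists_doorFamily_rootNumberPlus_of_liouvilleJacobi_bias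
    (hmod : Literature.NumberTheory.EllipticCurves.ModularForms.exists_isNewformOf) :
    ∃ Φ : CongruenceFamily₂, Φ.IsLarge ∧ (∀ p : ℕ, p.Prime → (Φ.residues p).Nonempty) ∧
      Φ.Mem ⟨-524, 450, -374, 3825⟩ ∧
      (∀ a : Params, Φ.Mem a →
        (a.curve.HasIrreducibleModPGaloisRep 3 ∧
          ∀ (C : VariableChange ℚ) (hC : (C • a.curve).IsGloballyMinimal),
            @Literature.NumberTheory.EllipticCurves.IsOrdinaryAt (C • a.curve) hC 3 _ ∧
            ∃ ℓ : ℕ, ∃ _ : Fact ℓ.Prime, ℓ ≠ 3 ∧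
              (C • a.curve).HasMultiplicativeReductionAtPrime ℓ ∧
              ¬ 3 ∣ padicValInt ℓ (@minimalDiscriminantInt (C • a.curve) hC)) ∧
        Squarefree a.curveInt.Δ ∧ (a.curve.torsionOrder = 1 ∧ 2 ≤ a.curve.mordellWeilRank) ∧
        a.curve.rootNumber =
          -∏ p ∈ a.curveInt.Δ.natAbs.primeFactors,
            (if p = 2 then (if (2 : ℤ) ∣ a.a₁ * a.a₃ then -1 else 1)
             else -J(-(a.curveInt.c₄ * a.curveInt.c₆) | p))) ∧
      ∀ θ : ℝ, θ < 2 / 3 →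
        Φ.AverageOnLE (fun a ↦ ((∏ p ∈ a.curveInt.Δ.natAbs.primeFactors,
          (if p = 2 then (if (2 : ℤ) ∣ a.a₁ * a.a₃ then -1 else 1)
           else -J(-(a.curveInt.c₄ * a.curveInt.c₆) | p)) : ℤ) : ℝ)) θ →
        ∃ ρ : ℝ, 1 / 6 < ρ ∧ Φ.DensityOnGE (fun a ↦ a.curve.rootNumber = 1) ρ := by
  obtain ⟨Φ, hL, hne, hmem, hall⟩ := exists_refinedDoorFamily
  have hsf : ∀ a : Params, Φ.Mem a → Squarefree a.curveInt.Δ := fun a ha ↦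
    squarefree_of_forall_not_sq_dvd (hall a ha).2.1
  have hΦ : ∀ a : Params, Φ.Mem a →
      ∀ p : ℕ, p.Prime → (p : ℤ) ∣ a.curveInt.Δ → ¬ (p : ℤ) ∣ a.curveInt.c₄ := fun a ha ↦
    forall_not_dvd_c₄_of_squarefree (hsf a ha)
  have hpos : ∀ᶠ X : ℕ in atTop, 0 < (Φ.below X).card := by
    refine Filter.eventually_atTop.mpr ⟨((⟨-524, 450, -374, 3825⟩ : Params).height).toNat + 1,
      fun X hX ↦ Finset.card_pos.mpr ⟨_, (Φ.mem_below_iff _ X).mpr ⟨hmem, ?_⟩⟩⟩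
    have h0 := Params.height_nonneg (⟨-524, 450, -374, 3825⟩ : Params)
    omega
  refine ⟨Φ, hL, hne, hmem, fun a ha ↦ ⟨(hall a ha).1, hsf a ha, (hall a ha).2.2.1,
    rootNumber_curve_eq_neg_prod_primeFactors_of_forall Φ hΦ hmod a ha⟩, fun θ hθ hA ↦ ?_⟩
  exact exists_gt_one_sixth_of_liouvilleJacobi_bias Φ hθ hΦ hmod hpos hA

/-! ### §4 The typed obstruction: I2 proves a weak-Chowla bias bound for `(Δ_{F₂}, J)` on the door family -/

/-- **I2 ⊢ weak Chowla on the door family.** If `RootNumberPlusLowerDensityLargeF2` holds then — modulo the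
Modularity Theorem — on the cell's refined door family `Φ***` (large, nonempty residues, squarefree `Δ(a)`
for every member) the EXPLICIT Liouville–Jacobi sign `σ(a) = ∏_{p ∣ Δ(a)} s_p(a)` (`s₂ = −1` iff
`2 ∣ a₁a₃`, `s_p = −J(−c₄(a)c₆(a) | p)`; for odd squarefree `Δ`, `σ(a) = μ(|Δ(a)|)·J(−c₄c₆ | |Δ(a)|)` up to
the sign convention) has a `limsup` average `≤ θ` for some `θ < 2/3`: any proof of crux I2 proves a
`2/3`-BIAS weak-Chowla statement for the Liouville function of the discriminant form of `F₂` twisted by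
a Jacobi symbol, over a congruence-sieve family (the ideation census's «I2 is (wC)-complete», one
direction, kernel-checked). [cite: Helfgott2004RootNumber, §1] [cite: BhargavaHo2022, §1] -/
theorem exists_doorFamily_liouvilleJacobi_bias_of_rootNumberPlusLowerDensityLargeF2
    (hmod : Literature.NumberTheory.EllipticCurves.ModularForms.exists_isNewformOf)
    (h2 : RootNumberPlusLowerDensityLargeF2) :
    ∃ Φ : CongruenceFamily₂, Φ.IsLarge ∧ (∀ p : ℕ, p.Prime → (Φ.residues p).Nonempty) ∧
      Φ.Mem ⟨-524, 450, -374, 3825⟩ ∧ (∀ a : Params, Φ.Mem a → Squarefree a.curveInt.Δ) ∧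
      ∃ θ : ℝ, θ < 2 / 3 ∧
        Φ.AverageOnLE (fun a ↦ ((∏ p ∈ a.curveInt.Δ.natAbs.primeFactors,
          (if p = 2 then (if (2 : ℤ) ∣ a.a₁ * a.a₃ then -1 else 1)
           else -J(-(a.curveInt.c₄ * a.curveInt.c₆) | p)) : ℤ) : ℝ)) θ := by
  obtain ⟨Φ, hL, hne, hmem, hall, -⟩ := exists_doorFamily_rootNumberPlus_of_liouvilleJacobi_bias hmod
  obtain ⟨ρ, hρ, hD⟩ := h2 Φ hL hne
  have hpos := eventually_card_below_pos_of_densityOnGE Φ hD (by linarith)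
  refine ⟨Φ, hL, hne, hmem, fun a ha ↦ (hall a ha).2.1, 1 - 2 * ρ, by linarith, fun ε hε ↦ ?_⟩
  filter_upwards [averageOnLE_neg_rootNumber_of_densityOnGE Φ hpos hD ε hε] with X hX
  refine le_of_eq_of_le ?_ hX
  unfold CongruenceFamily₂.averageOn
  congr 1
  refine Finset.sum_congr rfl fun a ha ↦ ?_
  have hw := (hall a ((Φ.mem_below_iff a X).mp ha).1).2.2.2
  show _ = -(a.curve.rootNumber : ℝ)
  rw [hw]
  push_cast
  ring

/-! ### §5 The explicit-bias form «I2sf» of the crux: weaker than I2, and it closes the leaf with I1 -/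

/-- **I2 ⇒ I2sf.** If `RootNumberPlusLowerDensityLargeF2` holds then — modulo the Modularity Theorem — on
EVERY large `Φ ⊆ F₂` with nonempty local conditions all of whose members have squarefree discriminant,
the explicit Liouville–Jacobi sign `σ(a) = ∏_{p ∣ Δ(a)} s_p(a)` has `limsup` average `≤ θ` for some
`θ < 2/3` («I2sf»: the crux in its own currency — a `2/3`-bias weak-Chowla bound for an explicit `±1`-valued
arithmetic function of four integers over congruence-sieve families; no root number, no `L`-function).
[cite: Helfgott2004RootNumber, §1] [cite: BhargavaHo2022, §1] -/
theorem liouvilleJacobiBias_of_rootNumberPlusLowerDensityLargeF2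
    (hmod : Literature.NumberTheory.EllipticCurves.ModularForms.exists_isNewformOf)
    (h2 : RootNumberPlusLowerDensityLargeF2) (Φ : CongruenceFamily₂) (hL : Φ.IsLarge)
    (hne : ∀ p : ℕ, p.Prime → (Φ.residues p).Nonempty)
    (hsf : ∀ a : Params, Φ.Mem a → Squarefree a.curveInt.Δ) :
    ∃ θ : ℝ, θ < 2 / 3 ∧
      Φ.AverageOnLE (fun a ↦ ((∏ p ∈ a.curveInt.Δ.natAbs.primeFactors,
        (if p = 2 then (if (2 : ℤ) ∣ a.a₁ * a.a₃ then -1 else 1)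
         else -J(-(a.curveInt.c₄ * a.curveInt.c₆) | p)) : ℤ) : ℝ)) θ := by
  obtain ⟨ρ, hρ, hD⟩ := h2 Φ hL hne
  have hpos := eventually_card_below_pos_of_densityOnGE Φ hD (by linarith)
  have hΦ : ∀ a : Params, Φ.Mem a →
      ∀ p : ℕ, p.Prime → (p : ℤ) ∣ a.curveInt.Δ → ¬ (p : ℤ) ∣ a.curveInt.c₄ := fun a ha ↦
    forall_not_dvd_c₄_of_squarefree (hsf a ha)
  refine ⟨1 - 2 * ρ, by linarith, fun ε hε ↦ ?_⟩
  filter_upwards [averageOnLE_neg_rootNumber_of_densityOnGE Φ hpos hD ε hε] with X hX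
  refine le_of_eq_of_le ?_ hX
  unfold CongruenceFamily₂.averageOn
  congr 1
  refine Finset.sum_congr rfl fun a ha ↦ ?_
  show _ = -(a.curve.rootNumber : ℝ)
  rw [rootNumber_curve_eq_neg_prod_primeFactors_of_forall Φ hΦ hmod a ((Φ.mem_below_iff a X).mp ha).1]
  push_cast
  ring

/-- **The leaf from the published inputs at `3`, I1, Modularity and I2sf ALONE.** If (hIn) the published
inputs at `3`, (h1) crux I1 `SelmerThreeAverageLargeF2`, (hmod) the Modularity Theorem, and (hbias) I2sf —
on every large `Φ` with nonempty local conditions whose members all have squarefree `Δ`, some `θ < 2/3`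
bounds the `limsup` average of the explicit sign `σ` — then the route's leaf
`PAdicBSDRankTwoPositiveProportion` holds: I2sf is applied to the refined door family `Φ***`
(`exists_refinedDoorFamily`: squarefree `Δ`, generic members and Schneider-at-`3` member-wise, the local
door conditions), the typed door turns it into `ρ > 1/6` there, and the first-moment door
`Theorems.leaf_of_local` runs with `A = 36`, `36 < 27 + 54ρ`. So the planner may re-type I2 as I2sf
(strictly weaker, by `liouvilleJacobiBias_of_rootNumberPlusLowerDensityLargeF2`) without touching the
leaf. [cite: BhargavaShankarTernary2015, §1 (first-moment method with parity)]
[cite: Helfgott2004RootNumber, §1] -/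
theorem pAdicBSDRankTwoPositiveProportion_of_selmerAverage_of_liouvilleJacobiBias
    (hIn : PublishedInputsAtThree) (h1 : SelmerThreeAverageLargeF2)
    (hmod : Literature.NumberTheory.EllipticCurves.ModularForms.exists_isNewformOf)
    (hbias : ∀ Φ : CongruenceFamily₂, Φ.IsLarge → (∀ p : ℕ, p.Prime → (Φ.residues p).Nonempty) →
      (∀ a : Params, Φ.Mem a → Squarefree a.curveInt.Δ) →
      ∃ θ : ℝ, θ < 2 / 3 ∧
        Φ.AverageOnLE (fun a ↦ ((∏ p ∈ a.curveInt.Δ.natAbs.primeFactors,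
          (if p = 2 then (if (2 : ℤ) ∣ a.a₁ * a.a₃ then -1 else 1)
           else -J(-(a.curveInt.c₄ * a.curveInt.c₆) | p)) : ℤ) : ℝ)) θ) :
    PAdicBSDRankTwoPositiveProportion := by
  obtain ⟨Φ, hL, hne, hmem, hall⟩ := exists_refinedDoorFamily
  have hsf : ∀ a : Params, Φ.Mem a → Squarefree a.curveInt.Δ := fun a ha ↦
    squarefree_of_forall_not_sq_dvd (hall a ha).2.1
  have hΦ : ∀ a : Params, Φ.Mem a →
      ∀ p : ℕ, p.Prime → (p : ℤ) ∣ a.curveInt.Δ → ¬ (p : ℤ) ∣ a.curveInt.c₄ := fun a ha ↦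
    forall_not_dvd_c₄_of_squarefree (hsf a ha)
  have hpos : ∀ᶠ X : ℕ in atTop, 0 < (Φ.below X).card := by
    refine Filter.eventually_atTop.mpr ⟨((⟨-524, 450, -374, 3825⟩ : Params).height).toNat + 1,
      fun X hX ↦ Finset.card_pos.mpr ⟨_, (Φ.mem_below_iff _ X).mpr ⟨hmem, ?_⟩⟩⟩
    have h0 := Params.height_nonneg (⟨-524, 450, -374, 3825⟩ : Params)
    omega
  obtain ⟨θ, hθ, hA⟩ := hbias Φ hL hne hsf
  obtain ⟨ρ, hρ, hW⟩ := exists_gt_one_sixth_of_liouvilleJacobi_bias Φ hθ hΦ hmod hpos hA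
  have hGen : Φ.HasDensityOn (fun a ↦ 2 ≤ a.curve.mordellWeilRank) 1 :=
    CountingDoorF2AtThreeSchneiderOnDoorSubfamilyStubHasDensityOnOneOfForall.stub_hasDensityOn_one_of_forall
      Φ _ ⟨_, hmem⟩ fun a ha ↦ (hall a ha).2.2.1.2
  have hSchD := CountingDoorF2AtThreeSchneiderOnDoorSubfamilyStubHasDensityOnOneOfForall.stub_hasDensityOn_one_of_forall
      Φ _ ⟨_, hmem⟩ fun a ha ↦ (hall a ha).2.2.2
  exact leaf_of_local Φ hL (fun a ha ↦ (hall a ha).1) hIn hGen (h1 Φ hL) hW (by linarith) (by linarith)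
    hSchD

/-- **The trade-off between the Selmer average and the root-number bias.** With a CAPPED `3`-Selmer
average bound `A` on large families (I1cap-type input, `limsup avg min(#Sel₃, 81) ≤ A`) the leaf needs the
explicit-sign bias bound only with `27θ + A < 54` (and `θ < 1`): `A = 36 ⇒ θ < 2/3` (I2sf),
`A = 45 ⇒ θ < 1/3`, `A ↓ 27 ⇒ any θ < 1` («`w = −1` is not of density one»), `A ≥ 54 ⇒` no bias
suffices (the first-moment door is shut). Modulo the published inputs at `3` and Modularity.
[cite: BhargavaShankarTernary2015, §1 (first-moment method with parity)] [cite: Helfgott2004RootNumber, §1] -/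
theorem pAdicBSDRankTwoPositiveProportion_of_cappedAverage_of_liouvilleJacobiBias
    (hIn : PublishedInputsAtThree)
    (hmod : Literature.NumberTheory.EllipticCurves.ModularForms.exists_isNewformOf) {A : ℝ}
    (h1 : ∀ Φ : CongruenceFamily₂, Φ.IsLarge →
      Φ.AverageOnLE (fun a ↦ min (Nat.card (a.curve.selmerGroup 3) : ℝ) 81) A)
    (hbias : ∀ Φ : CongruenceFamily₂, Φ.IsLarge → (∀ p : ℕ, p.Prime → (Φ.residues p).Nonempty) →
      (∀ a : Params, Φ.Mem a → Squarefree a.curveInt.Δ) →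
      ∃ θ : ℝ, θ < 1 ∧ 27 * θ + A < 54 ∧
        Φ.AverageOnLE (fun a ↦ ((∏ p ∈ a.curveInt.Δ.natAbs.primeFactors,
          (if p = 2 then (if (2 : ℤ) ∣ a.a₁ * a.a₃ then -1 else 1)
           else -J(-(a.curveInt.c₄ * a.curveInt.c₆) | p)) : ℤ) : ℝ)) θ) :
    PAdicBSDRankTwoPositiveProportion := by
  obtain ⟨Φ, hL, hne, hmem, hall⟩ := exists_refinedDoorFamily
  have hsf : ∀ a : Params, Φ.Mem a → Squarefree a.curveInt.Δ := fun a ha ↦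
    squarefree_of_forall_not_sq_dvd (hall a ha).2.1
  have hΦ : ∀ a : Params, Φ.Mem a →
      ∀ p : ℕ, p.Prime → (p : ℤ) ∣ a.curveInt.Δ → ¬ (p : ℤ) ∣ a.curveInt.c₄ := fun a ha ↦
    forall_not_dvd_c₄_of_squarefree (hsf a ha)
  have hpos : ∀ᶠ X : ℕ in atTop, 0 < (Φ.below X).card := by
    refine Filter.eventually_atTop.mpr ⟨((⟨-524, 450, -374, 3825⟩ : Params).height).toNat + 1,
      fun X hX ↦ Finset.card_pos.mpr ⟨_, (Φ.mem_below_iff _ X).mpr ⟨hmem, ?_⟩⟩⟩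
    have h0 := Params.height_nonneg (⟨-524, 450, -374, 3825⟩ : Params)
    omega
  obtain ⟨θ, hθ1, hθA, hA⟩ := hbias Φ hL hne hsf
  have hW := densityOnGE_rootNumber_of_liouvilleJacobi_averageOnLE Φ hΦ hmod hpos hA
  have hGen : Φ.HasDensityOn (fun a ↦ 2 ≤ a.curve.mordellWeilRank) 1 :=
    CountingDoorF2AtThreeSchneiderOnDoorSubfamilyStubHasDensityOnOneOfForall.stub_hasDensityOn_one_of_forall
      Φ _ ⟨_, hmem⟩ fun a ha ↦ (hall a ha).2.2.1.2
  have hSchD := CountingDoorF2AtThreeSchneiderOnDoorSubfamilyStubHasDensityOnOneOfForall.stub_hasDensityOn_one_of_forall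
      Φ _ ⟨_, hmem⟩ fun a ha ↦ (hall a ha).2.2.2
  exact leaf_of_local_capped Φ hL (fun a ha ↦ (hall a ha).1) hIn hGen (h1 Φ hL) hW (by linarith)
    (by linarith) hSchD

end Summit.BirchSwinnertonDyer.BirchSwinnertonDyer.Theorems.F2RootNumber

end
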